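import Summits.PneNP.GCT.Max.DetKYLeadingTermsFamily
import Summits.PneNP.GCT.Max.SF6Arithmetic
import Literature.Computability.AlgebraicComplexity.PolynomialKoszulYoungFlatteningLeadingTerms
import Mathlib.Combinatorics.Colex
import HarnessLib
import HarnessLib.Audit

/-!
# `GCT/Max`: the leading-term lower bound `max(LT, LT^dual) ≤ rank KY_{p,k}(det_n)` — counting, triangularity, duality

Cell `pub-gct-max` (HOME `run/shared/lean/pub/pub-gct-max/`), track F, Lean port S-F-6 (lead D53/D65; referee read
2026-08-23T04:57:52Z, no objection, R1–R4); typed/proved by lit-2, mathematics owner theory-2 (`CF3-THEOREM.md` §2–§3).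
Second half of the leading-term family of `det_n` (first half: `DetKYLeadingTermsFamily.lean` — the family `𝒟(n,c,k)`, its
derivative lists and wedge parts, the value `ε·(± minor)` at the leading index; the count `LT` = `DetKYLeadingTerms.ltCount`
is defined in `SF6Arithmetic.lean`). HERE: `|𝒟(n,c,k)| = LT(n,c,k)` (`card_Idx`); canonical derivatives (signed minors) with
different (rows, columns) labels have DISJOINT supports (`disjoint_support_canon`); TRIANGULARITY in the colex order on the
`(p+1)`-sets (`kyImage_eq_zero_of_le`, Mathlib `Finset.Colex.insert_lt_insert`); members of a block are determined by their
labels (`eq_of_labels_eq`); hence, by the tree's `card_le_kyRankFin_of_leading_disjoint` (Cox–Little–O'Shea Ch. 9 §3),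
**`LT(n, c, k) ≤ rank KY_{p,k}(det_n)` for `c + p + 1 = n²` over any field** (`LT_le_kyRankFin_detFin`,
`LT_le_kyRank_detPoly`); with the tree's transpose duality `kyRankFin_dual` (char. `0`) also the dual count
(`kyRank_detPoly_dual`, `max_LT_le_kyRank_detPoly`), packaged as `DetKYLeadingTermBound` (= the hypotheses `HypLT ∧ HypDualDet`
of theory-2's kernel-checked assembly skeleton `SF6Assembly.lean` `070a324692f9b2dc`) with `detKYLeadingTermBound_holds`.
Everything PROVED (0 sorry); no conjecture of the cell is used or asserted. Print status: the device is textbook, the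
family/count are the cell's, no printed source states the bound (lit-2 presearch 2026-08-23). HONEST FRAMING: multiplicity
data and certified rank bounds at small parameters; occurrence obstructions are ruled out in print (BIP'16) — multiplicity
obstructions are the open door; nothing here is a claim on VP vs VNP or P vs NP.

## References (as printed: `HOME/typed/AS-PRINTED-2.md` §F)
* [LandsbergGCT2017] §8.2.1 eq. (8.2.1), §2.4 (duality); Exercise 6.2.2.7 / (7.6.10).  * [Guan2016] §1.3.
* [CoxLittleOShea2007] Ch. 9 §3, proof of Prop. 4.  * [Farnsworth2016] Thm. 1.6 (computer ranks of `det₄`).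
-/

noncomputable section

open MvPolynomial Finset

namespace Summit.PneNP.GCT

open Literature.Computability.AlgebraicComplexity Literature.Barriers.ValiantsHypothesis

namespace DetKYLeadingTerms

variable {K : Type*} [Field K] {n c k : ℕ}

/-! ### Counting and the remaining bookkeeping of the family -/

/-- `|𝒟(n, c, k)| = ltCount(n, c, k)` (product of the three binomials, summed over the distinguished position). [folklore] -/
theorem card_Idx (n c k : ℕ) : Fintype.card (Idx n c k) = ltCount n c k := by
  unfold ltCount
  rw [Fintype.card_sigma, Fintype.sum_prod_type]
  refine Finset.sum_congr rfl fun i _ => Finset.sum_congr rfl fun j _ => ?_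
  simp only [Fintype.card_prod, Fintype.card_coe, card_powersetCard, Fin.card_Iio,
    finProdFinEquiv_apply_val]
  rw [show (j : ℕ) + n * i = i * n + j by ring, mul_assoc]

section Components

variable (x : Idx n c k)

/-- Elements of `rowSet` are `< row`. [folklore] -/
theorem lt_row_of_mem {r : Fin n} (h : r ∈ rowSet x) : r < row x := mem_Iio.1 ((rowSet_spec x).1 h)

/-- Elements of `colSet` are `< col`. [folklore] -/
theorem lt_col_of_mem {s : Fin n} (h : s ∈ colSet x) : s < col x := mem_Iio.1 ((colSet_spec x).1 h)

/-- Elements of `free` are `< dpos`. [folklore] -/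
theorem lt_dpos_of_mem {t : Fin (n * n)} (h : t ∈ free x) : t < dpos x := mem_Iio.1 ((free_spec x).1 h)

/-- `perm(colSet) = rowSet`. [folklore] -/
theorem map_perm_colSet : (colSet x).map (perm x).toEmbedding = rowSet x := (exists_perm x).choose_spec.2

/-- `perm(colSet ⊔ {col}) = rowSet ⊔ {row}`. [folklore] -/
theorem map_perm_insert :
    (insert (col x) (colSet x)).map (perm x).toEmbedding = insert (row x) (rowSet x) := by
  rw [map_insert, map_perm_colSet, Equiv.toEmbedding_apply, perm_col]

/-- The derivative list has length `k`. [folklore] -/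
theorem length_dl : (dl x).length = k := by
  rw [dl, dlist, List.length_map, List.length_map, colList, length_toList, (colSet_spec x).2]

/-- `|S| = p` when `c + p + 1 = n²`. [folklore] -/
theorem card_wS {p : ℕ} (h : c + p + 1 = n * n) : (wS x).card = p := by
  rw [wS, card_compl, card_insert_of_notMem (dpos_notMem_free x), (free_spec x).2, Fintype.card_fin]
  omega

/-- Outside `S` there are only `dpos` and the free positions. [folklore] -/
theorem mem_of_notMem_wS {t : Fin (n * n)} (ht : t ∉ wS x) : t = dpos x ∨ t ∈ free x := by
  rw [wS, mem_compl, not_not, mem_insert] at ht; exact ht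


end Components

/-! ### Supports of canonical derivatives -/

section Support

/-- The monomials of a canonical derivative are the square-free monomials `∏_{b ∉ B} x_{π b, b}`, `π|_B = π₀|_B`. [folklore] -/
theorem support_canon_subset (cf : Equiv.Perm (Fin n) → K) (π₀ : Equiv.Perm (Fin n)) (B : Finset (Fin n)) :
    (canon cf π₀ B).support ⊆
      (univ.filter fun π : Equiv.Perm (Fin n) => ∀ b ∈ B, π b = π₀ b).image
        fun π => sqfree (offGraph π B) := by
  intro m hm
  rw [canon] at hm
  obtain ⟨π, hπ, hmπ⟩ := mem_biUnion.1 (support_sum hm)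
  have h1 := support_monomial_subset hmπ
  rw [mem_singleton] at h1
  exact mem_image.2 ⟨π, hπ, h1.symm⟩

/-- Permutations agreeing on `B` have the same image of `B`. [folklore] -/
theorem map_toEmbedding_eq_of_agree {π π₀ : Equiv.Perm (Fin n)} {B : Finset (Fin n)}
    (h : ∀ b ∈ B, π b = π₀ b) : B.map π.toEmbedding = B.map π₀.toEmbedding := by
  ext r
  simp only [mem_map, Equiv.toEmbedding_apply]
  constructor
  · rintro ⟨b, hb, rfl⟩; exact ⟨b, hb, (h b hb).symm⟩
  · rintro ⟨b, hb, rfl⟩; exact ⟨b, hb, h b hb⟩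

/-- Canonical derivatives with different (row set, column set) have disjoint supports. [folklore] -/
theorem disjoint_support_canon (cf cf' : Equiv.Perm (Fin n) → K) {π₀ π₁ : Equiv.Perm (Fin n)}
    {B B' : Finset (Fin n)}
    (h : ¬ (B = B' ∧ B.map π₀.toEmbedding = B'.map π₁.toEmbedding)) :
    Disjoint (canon cf π₀ B).support (canon cf' π₁ B').support := by
  rw [Finset.disjoint_left]
  intro m hm hm'
  obtain ⟨π, hπ, rfl⟩ := mem_image.1 (support_canon_subset _ _ _ hm)
  obtain ⟨π', hπ', heq⟩ := mem_image.1 (support_canon_subset _ _ _ hm')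
  have hπB := (mem_filter.1 hπ).2
  have hπ'B := (mem_filter.1 hπ').2
  have hoff : offGraph π' B' = offGraph π B := sqfree_injective heq
  have hBB : B' = B := eq_of_offGraph_eq_offGraph hoff
  subst hBB
  apply h
  refine ⟨rfl, ?_⟩
  rw [← map_toEmbedding_eq_of_agree hπB, ← map_toEmbedding_eq_of_agree hπ'B]
  exact (map_eq_map_of_offGraph_eq hoff).symm

end Support

/-! ### Triangularity and the block structure -/

section Triangular

variable (x : Idx n c k)

/-- **Triangularity**: the image of the member `x` vanishes at every `T ≠ lead x` that is colex-`≥ lead x` (its support consists of `S ⊔ {t}`, `t` free or `t = dpos`, and `S ⊔ {t} <_colex S ⊔ {dpos}` for `t < dpos` — Mathlib's `Finset.Colex.insert_lt_insert`). [folklore] -/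
theorem kyImage_eq_zero_of_le (T : Finset (Fin (n * n))) (hT : T ≠ lead x)
    (hle : toColex (lead x) ≤ toColex T) : kyImage (detFin K n) (dl x) (wS x) T = 0 := by
  apply kyImage_apply_eq_zero
  intro t ht hTeq
  rcases mem_of_notMem_wS x ht with h | h
  · exact hT (by rw [hTeq, h, lead_eq_insert])
  · have hlt : toColex T < toColex (lead x) := by
      rw [hTeq, lead_eq_insert]
      exact (Colex.insert_lt_insert ht (dpos_notMem_wS x)).2 (lt_dpos_of_mem x h)
    exact absurd hle (not_le.2 hlt)

/-- Members of a block (same leading set) with the same (rows, columns) label coincide. [folklore] -/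
theorem eq_of_labels_eq {x y : Idx n c k} (hlead : lead x = lead y) (hcol : colB x = colB y)
    (hrow : insert (row x) (rowSet x) = insert (row y) (rowSet y)) : x = y := by
  have hfree : free x = free y := compl_injective hlead  -- check name
  have hc : col x = col y := by
    have h1 : col y ∈ colB x := by rw [hcol]; exact mem_insert_self _ _
    have h2 : col x ∈ colB y := by rw [← hcol]; exact mem_insert_self _ _
    rcases mem_insert.1 h1 with h1 | h1
    · exact h1.symm
    rcases mem_insert.1 h2 with h2 | h2
    · exact h2
    exact absurd ((lt_col_of_mem x h1).trans (lt_col_of_mem y h2)) (lt_irrefl _)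
  have hr : row x = row y := by
    have h1 : row y ∈ insert (row x) (rowSet x) := by rw [hrow]; exact mem_insert_self _ _
    have h2 : row x ∈ insert (row y) (rowSet y) := by rw [← hrow]; exact mem_insert_self _ _
    rcases mem_insert.1 h1 with h1 | h1
    · exact h1.symm
    rcases mem_insert.1 h2 with h2 | h2
    · exact h2
    exact absurd ((lt_row_of_mem x h1).trans (lt_row_of_mem y h2)) (lt_irrefl _)
  have hcs : colSet x = colSet y := by
    rw [colB, colB, hc] at hcol
    have hnot : col y ∉ colSet x := hc ▸ col_notMem_colSet x
    rw [← erase_insert hnot, hcol, erase_insert (col_notMem_colSet y)]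
  have hrs : rowSet x = rowSet y := by
    rw [hr] at hrow
    have hnot : row y ∉ rowSet x := hr ▸ row_notMem_rowSet x
    rw [← erase_insert hnot, hrow, erase_insert (row_notMem_rowSet y)]
  obtain ⟨⟨i, j⟩, ⟨I, hI⟩, ⟨J, hJ⟩, ⟨A, hA⟩⟩ := x
  obtain ⟨⟨i', j'⟩, ⟨I', hI'⟩, ⟨J', hJ'⟩, ⟨A', hA'⟩⟩ := y
  simp only [row, col, rowSet, colSet, free] at hc hr hcs hrs hfree
  subst hc hr hcs hrs hfree
  rfl

/-- The support of the value at the leading index, transported to matrix coordinates, lies in the support of the canonical derivative. [folklore] -/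
theorem support_value_subset (x : Idx n c k) :
    (kyImage (detFin K n) (dl x) (wS x) (lead x)).support ⊆
      (canon (sgnK K n) (perm x) (colB x)).support.image (Finsupp.mapDomain (vpos n)) := by
  rw [kyImage_lead, ← map_intCast (C : K →+* MvPolynomial (Fin (n * n)) K), C_mul',
    ← support_rename_of_injective (vpos n).injective]
  exact support_smul

/-- **Diagonal blocks**: distinct members with the same leading set have disjointly supported leading values. [folklore] -/
theorem disjoint_support_lead {x y : Idx n c k} (hxy : x ≠ y) (hlead : lead x = lead y) :
    Disjoint (kyImage (detFin K n) (dl x) (wS x) (lead x)).support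
      (kyImage (detFin K n) (dl y) (wS y) (lead y)).support := by
  have hlab : ¬ (colB x = colB y ∧
      (colB x).map (perm x).toEmbedding = (colB y).map (perm y).toEmbedding) := by
    rintro ⟨hB, hmap⟩
    rw [colB, colB, map_perm_insert, map_perm_insert] at hmap
    exact hxy (eq_of_labels_eq hlead hB hmap)
  refine Disjoint.mono (support_value_subset x) (support_value_subset y) ?_
  rw [disjoint_image (Finsupp.mapDomain_injective (vpos n).injective)]
  exact disjoint_support_canon _ _ hlab

end Triangular

/-! ### The lower bound -/

section Bound

variable (K : Type*) [Field K]

/-- **(i-b)** `ltCount(n, c, k) ≤ rank KY_{p,k}(det_n)` whenever `c + p + 1 = n²` (numbered coordinates). [folklore] -/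
theorem LT_le_kyRankFin_detFin (n c k p : ℕ) (h : c + p + 1 = n * n) :
    ltCount n c k ≤ kyRankFin K p k (detFin K n) := by
  rw [← card_Idx]
  exact card_le_kyRankFin_of_leading_disjoint (detFin K n) (fun x : Idx n c k => dl x) (fun x => wS x)
    (fun x => length_dl x) (fun x => card_wS x h) (fun x => lead x) (fun T => toColex T)
    (fun x T hT hle => kyImage_eq_zero_of_le x T hT hle) (fun x => kyImage_lead_ne_zero x)
    (fun x y hxy hl => disjoint_support_lead hxy hl)

/-- **(i-b), numbering-free form**: for `p + 1 ≤ n²`, `ltCount(n, n²-1-p, k) ≤ rank KY_{p,k}(det_n)`. [folklore] -/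
theorem LT_le_kyRank_detPoly (n p k : ℕ) (hp : p + 1 ≤ n * n) :
    ltCount n (n * n - 1 - p) k ≤ kyRank K p k (detPoly (Fin n) K) := by
  rw [kyRank_detPoly_eq_kyRankFin_detFin]
  exact LT_le_kyRankFin_detFin K n _ k p (by omega)

/-- **Transpose duality for `det_n`** (the tree's `kyRankFin_dual` instantiated; characteristic `0`): for
`p + 1 ≤ n²` and `k + 1 ≤ n`, `rank KY_{p,k}(det_n) = rank KY_{n²-1-p, n-1-k}(det_n)`.
[cite: LandsbergGCT2017, §2.4 and §8.2.1 (the map (8.2.1) is a `GL(V)`-module map)] -/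
theorem kyRank_detPoly_dual [CharZero K] (n p k : ℕ) (hp : p + 1 ≤ n * n) (hk : k + 1 ≤ n) :
    kyRank K p k (detPoly (Fin n) K) = kyRank K (n * n - 1 - p) (n - 1 - k) (detPoly (Fin n) K) := by
  rw [kyRank_detPoly_eq_kyRankFin_detFin, kyRank_detPoly_eq_kyRankFin_detFin]
  exact kyRankFin_dual (detFin_isHomogeneous n) p k hp hk

/-- Both leading-term counts at once: for `p + 1 ≤ n²`, `k + 1 ≤ n` (characteristic `0`),
`max (ltCount(n, n²-1-p, k)) (ltCount(n, p, n-1-k)) ≤ rank KY_{p,k}(det_n)`. [folklore] -/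
theorem max_LT_le_kyRank_detPoly [CharZero K] (n p k : ℕ) (hp : p + 1 ≤ n * n) (hk : k + 1 ≤ n) :
    max (ltCount n (n * n - 1 - p) k) (ltCount n p (n - 1 - k)) ≤ kyRank K p k (detPoly (Fin n) K) := by
  refine max_le (LT_le_kyRank_detPoly K n p k hp) ?_
  have h := LT_le_kyRank_detPoly K n (n * n - 1 - p) (n - 1 - k) (by omega)
  rw [show n * n - 1 - (n * n - 1 - p) = p by omega, ← kyRank_detPoly_dual K n p k hp hk] at h
  exact h

end Bound

/- Sanity (theory-2's det₃ numbers, CF3-THEOREM §2): `ltCount(3, p=4, k=1) = 361` is `ltCount 3 4 1` (`c = 9-1-4`). -/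
example : ltCount 3 4 1 = 361 := by decide
example : ltCount 3 6 1 = 126 := by decide
example : ltCount 3 1 2 = 8 := by decide

end DetKYLeadingTerms

/-! ## The packaged statement (obligation node of this module, PROVED) -/

/-- **(i-b) + (iii) for `det_n`, packaged** (= the hypotheses `HypLT`, `HypDualDet` of theory-2's assembly skeleton): for
all `n, p, k` with `p + 1 ≤ n²`, `k + 1 ≤ n`,
`max (ltCount(n, n²-1-p, k)) (ltCount(n, p, n-1-k)) ≤ rank KY_{p,k}(det_n)` over `ℂ`. A statement of the cell (CF3-THEOREM §2–§3),
PROVED below; not a published theorem. [folklore] -/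
def DetKYLeadingTermBound : Prop :=
  ∀ n p k : ℕ, p + 1 ≤ n * n → k + 1 ≤ n →
    max (DetKYLeadingTerms.ltCount n (n * n - 1 - p) k) (DetKYLeadingTerms.ltCount n p (n - 1 - k)) ≤
      kyRank ℂ p k (detPoly (Fin n) ℂ)

/-- `DetKYLeadingTermBound` holds. [folklore] -/
theorem detKYLeadingTermBound_holds : DetKYLeadingTermBound :=
  fun n p k hp hk => DetKYLeadingTerms.max_LT_le_kyRank_detPoly ℂ n p k hp hk

end Summit.PneNP.GCT
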